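import Mathlib.Tactic.Group
import Mathlib.Topology.Algebra.FilterBasis
import Mathlib.Topology.Algebra.Group.Pointwise
import Literature.AnabelianGeometry.SemiGraphs.NotationsConventions
import HarnessLib

/-!
# The topology of an outer semi-direct product `G ⋊^out J` along an invariant basis of levels ([SemiAnbd] §0 p. 5)

Mochizuki, *Semi-graphs of anabelioids*, Publ. RIMS **42** (2006) 221–322, §0 "Topological Groups",
p. 5 [cite: MochizukiSemiAnbd2006, §0 p.5]: for a topological group `G` with centre-free image in
`Aut(G)` and a continuous outer action `J → Out(G)` one has the outer semi-direct product
`G ⋊^out J := Aut(G) ×_{Out(G)} J` and "a natural exact sequence `1 → G → G ⋊^out J → J → 1`".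
The tree's `SemiGraphs.outerSemidirectProduct ρ` (`NotationsConventions.lean`, abc-iut-L3-d2 lineage)
is the ALGEBRAIC fibre product inside `EtaleTheta.contMulAut G × J`; print's `Aut(G)`, `Out(G)` are
TOPOLOGICAL groups, and the exact sequence is one of topological groups.

GENERIC TOPOLOGICAL LAYER (abc-iut cell, GAP row «G-P13-GR» of abc-iut-L4-lead RULING #5n (3) /
abc-iut-L3-lead α37; consumer [AbsTopII] Prop 1.3 `Π_H := Π_𝔾 ⋊^out H`, and the tempered outer model
of [SemiAnbd] Thm 5.4, row T54·E-top).  INPUT: a family of LEVELS `N : ι → Subgroup G` — directed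
downwards, forming a neighbourhood basis of `1` where needed, and INVARIANT under (the first components
of) `G ⋊^out J`, i.e. under the outer action — and the topology of `J`.  OUTPUT:

* `outerSemidirectProduct.levelNhd ρ N V` — the identity neighbourhoods "first component congruent to
  the identity modulo `N`, second component in `V`";
* `outerSemidirectProduct.filterBasis` / `outerSemidirectProduct.topology` — the GROUP topology they
  generate (Mathlib `GroupFilterBasis`); it is a `def`, never an instance: consumers write
  `letI := outerSemidirectProduct.topology ρ N hdir hinv`;
* PROVED: `G ⋊^out J` is a topological group; the projection to `J` is continuous, and OPEN under the
  continuity of the outer action (`isOpenMap_snd_of_levels`); `G → G ⋊^out J` is continuous when the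
  levels are neighbourhoods of `1`, and a topological EMBEDDING when the "centre-modulo-level" subgroups
  `{g | ∀ x, x⁻¹ g x g⁻¹ ∈ N i}` shrink to `1` (`isInducing_toOuterSemidirectProduct_of`); Hausdorff
  when `G` is Hausdorff with `N` a neighbourhood basis and `J` is Hausdorff; and the ALGEBRAIC exactness
  of `1 → G → G ⋊^out J → J → 1` for centre-free `G` at arbitrary universes.

No compactness here (the profinite packaging — `Aut(G)` profinite for topologically finitely generated
profinite `G`, `G ⋊^out J` a `ProfiniteGrp` — is a separate file).  Nothing here bears on
[IUTchIII] Cor. 3.12.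
-/

namespace Literature.AnabelianGeometry.SemiGraphs

namespace outerSemidirectProduct

open Literature.AnabelianGeometry.EtaleTheta
open Filter Topology
open scoped Pointwise

universe u v w

/-! ### Congruence modulo a level, for automorphisms -/

section Congr

variable {G : Type u} [Group G]

/-- The congruence clause `g⁻¹ φ(g) ∈ N` is multiplicative, given that the LEFT factor preserves the
level. [cite: MochizukiSemiAnbd2006, §0 p.5] -/
theorem congr_mul {N : Subgroup G} {φ ψ : MulAut G} (hφ : ∀ g : G, g⁻¹ * φ g ∈ N)
    (hψ : ∀ g : G, g⁻¹ * ψ g ∈ N) (hφN : ∀ g ∈ N, φ g ∈ N) (g : G) :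
    g⁻¹ * (φ * ψ) g ∈ N := by
  rw [MulAut.mul_apply]
  have h : g⁻¹ * φ (ψ g) = (g⁻¹ * φ g) * φ (g⁻¹ * ψ g) := by
    rw [map_mul, map_inv]; group
  rw [h]
  exact N.mul_mem (hφ g) (hφN _ (hψ g))

/-- The congruence clause passes to inverses. [cite: MochizukiSemiAnbd2006, §0 p.5] -/
theorem congr_inv {N : Subgroup G} {φ : MulAut G} (hφ : ∀ g : G, g⁻¹ * φ g ∈ N) (g : G) :
    g⁻¹ * φ⁻¹ g ∈ N := by
  have h := N.inv_mem (hφ (φ⁻¹ g))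
  rw [mul_inv_rev, inv_inv] at h
  have h' : φ (φ⁻¹ g) = g := by
    rw [← MulAut.mul_apply, mul_inv_cancel, MulAut.one_apply]
  rwa [h'] at h

/-- The congruence clause is stable under conjugation by an automorphism preserving the level.
[cite: MochizukiSemiAnbd2006, §0 p.5] -/
theorem congr_conj {N : Subgroup G} {φ ψ : MulAut G} (hφ : ∀ g : G, g⁻¹ * φ g ∈ N)
    (hψN : ∀ g ∈ N, ψ g ∈ N) (g : G) : g⁻¹ * (ψ * φ * ψ⁻¹) g ∈ N := by
  rw [MulAut.mul_apply, MulAut.mul_apply]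
  have h1 : ψ (ψ⁻¹ g) = g := by
    rw [← MulAut.mul_apply, mul_inv_cancel, MulAut.one_apply]
  have h : g⁻¹ * ψ (φ (ψ⁻¹ g)) = ψ ((ψ⁻¹ g)⁻¹ * φ (ψ⁻¹ g)) := by
    rw [map_mul, map_inv, h1]
  rw [h]
  exact hψN _ (hφ _)

/-- The congruence clause for an inner automorphism: `x⁻¹ (g x g⁻¹) ∈ N` for all `x` as soon as
`g ∈ N` and `N` is normal. [cite: MochizukiSemiAnbd2006, §0 p.5] -/
theorem congr_conj_of_mem {N : Subgroup G} [N.Normal] {g : G} (hg : g ∈ N) (x : G) :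
    x⁻¹ * (MulAut.conj g) x ∈ N := by
  rw [MulAut.conj_apply]
  have : x⁻¹ * (g * x * g⁻¹) = (x⁻¹ * g * x) * g⁻¹ := by group
  rw [this]
  exact N.mul_mem (by simpa using Subgroup.Normal.conj_mem ‹N.Normal› g hg x⁻¹) (N.inv_mem hg)

end Congr

section Levels

variable {G : Type u} [Group G] [TopologicalSpace G]
variable {J : Type v} [Group J]
variable (ρ : J →* TopOut G)

/-! ### Identity neighbourhoods attached to a level -/

/-- The identity neighbourhood of `G ⋊^out J` attached to a level `N ≤ G` and a subset `V ⊆ J`: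
pairs `(φ, j)` with `φ ≡ id (mod N)` (`g⁻¹ φ(g) ∈ N` for all `g`) and `j ∈ V`.
[cite: MochizukiSemiAnbd2006, §0 p.5] -/
def levelNhd (N : Subgroup G) (V : Set J) : Set (outerSemidirectProduct ρ) :=
  {e | (∀ g : G, g⁻¹ * (e.1.1 : MulAut G) g ∈ N) ∧ e.1.2 ∈ V}

/-- Membership in `levelNhd`. [cite: MochizukiSemiAnbd2006, §0 p.5] -/
theorem mem_levelNhd {N : Subgroup G} {V : Set J} {e : outerSemidirectProduct ρ} :
    e ∈ levelNhd ρ N V ↔ (∀ g : G, g⁻¹ * (e.1.1 : MulAut G) g ∈ N) ∧ e.1.2 ∈ V := Iff.rfl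

/-- `levelNhd` is monotone in both arguments. [cite: MochizukiSemiAnbd2006, §0 p.5] -/
theorem levelNhd_mono {N N' : Subgroup G} {V V' : Set J} (hN : N ≤ N') (hV : V ⊆ V') :
    levelNhd ρ N V ⊆ levelNhd ρ N' V' :=
  fun _ he => ⟨fun g => hN (he.1 g), hV he.2⟩

/-- `1 ∈ levelNhd N V` as soon as `1 ∈ V`. [cite: MochizukiSemiAnbd2006, §0 p.5] -/
theorem one_mem_levelNhd (N : Subgroup G) {V : Set J} (hV : (1 : J) ∈ V) :
    (1 : outerSemidirectProduct ρ) ∈ levelNhd ρ N V :=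
  ⟨fun g => by simp, hV⟩

end Levels

/-! ### The group filter basis and the topology -/

section Topology

variable {G : Type u} [Group G] [TopologicalSpace G]
variable {J : Type v} [Group J] [TopologicalSpace J] [IsTopologicalGroup J]
variable (ρ : J →* TopOut G) {ι : Type w} [Nonempty ι] (N : ι → Subgroup G) (hdir : Directed (· ≥ ·) N)
  (hinv : ∀ (i : ι) (e : outerSemidirectProduct ρ) (g : G), g ∈ N i → (e.1.1 : MulAut G) g ∈ N i)

/-- **The group filter basis of `G ⋊^out J` along the invariant levels `N`**: the sets
`levelNhd (N i) V`, `V` a neighbourhood of `1 ∈ J`. [cite: MochizukiSemiAnbd2006, §0 p.5] -/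
@[reducible] def filterBasis : GroupFilterBasis (outerSemidirectProduct ρ) where
  sets := {S | ∃ i, ∃ V ∈ 𝓝 (1 : J), S = levelNhd ρ (N i) V}
  nonempty := ⟨_, Classical.arbitrary ι, Set.univ, Filter.univ_mem, rfl⟩
  inter_sets := by
    rintro _ _ ⟨i, V, hV, rfl⟩ ⟨j, W, hW, rfl⟩
    obtain ⟨k, hki, hkj⟩ := hdir i j
    exact ⟨_, ⟨k, V ∩ W, Filter.inter_mem hV hW, rfl⟩,
      fun e he => ⟨levelNhd_mono ρ hki Set.inter_subset_left he,
        levelNhd_mono ρ hkj Set.inter_subset_right he⟩⟩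
  one' := by
    rintro _ ⟨i, V, hV, rfl⟩
    exact one_mem_levelNhd ρ (N i) (mem_of_mem_nhds hV)
  mul' := by
    rintro _ ⟨i, V, hV, rfl⟩
    obtain ⟨W, hW, hWV⟩ := exists_nhds_one_split hV
    refine ⟨_, ⟨i, W, hW, rfl⟩, ?_⟩
    rintro _ ⟨e, he, f, hf, rfl⟩
    refine ⟨fun g => ?_, hWV _ he.2 _ hf.2⟩
    exact congr_mul he.1 hf.1 (hinv i e) g
  inv' := by
    rintro _ ⟨i, V, hV, rfl⟩
    refine ⟨_, ⟨i, V⁻¹, inv_mem_nhds_one J hV, rfl⟩, fun e he => ?_⟩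
    refine ⟨fun g => ?_, by simpa using he.2⟩
    exact congr_inv he.1 g
  conj' := by
    rintro e₀ _ ⟨i, V, hV, rfl⟩
    have hc : Tendsto (fun j : J => e₀.1.2 * j * e₀.1.2⁻¹) (𝓝 1) (𝓝 1) := by
      have : Continuous (fun j : J => e₀.1.2 * j * e₀.1.2⁻¹) := by fun_prop
      simpa using this.tendsto 1
    refine ⟨_, ⟨i, _, hc hV, rfl⟩, fun e he => ?_⟩
    refine ⟨fun g => ?_, he.2⟩
    exact congr_conj he.1 (hinv i e₀) g

/-- The sets of the filter basis. [cite: MochizukiSemiAnbd2006, §0 p.5] -/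
theorem mem_filterBasis_iff {S : Set (outerSemidirectProduct ρ)} :
    S ∈ filterBasis ρ N hdir hinv ↔ ∃ i, ∃ V ∈ 𝓝 (1 : J), S = levelNhd ρ (N i) V := Iff.rfl

/-- **The topology of `G ⋊^out J` along the invariant levels `N`** (a `def`; consumers `letI` it).
[cite: MochizukiSemiAnbd2006, §0 p.5] -/
@[reducible] def topology : TopologicalSpace (outerSemidirectProduct ρ) := (filterBasis ρ N hdir hinv).topology

/-- `G ⋊^out J` is a topological group for this topology. [cite: MochizukiSemiAnbd2006, §0 p.5] -/
theorem isTopologicalGroup :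
    @IsTopologicalGroup (outerSemidirectProduct ρ) (topology ρ N hdir hinv) _ :=
  (filterBasis ρ N hdir hinv).isTopologicalGroup

/-- The identity neighbourhoods: `levelNhd (N i) V`, `V ∈ 𝓝 1`, form a basis of `𝓝 1`.
[cite: MochizukiSemiAnbd2006, §0 p.5] -/
theorem hasBasis_nhds_one :
    (@nhds _ (topology ρ N hdir hinv) 1).HasBasis (fun p : ι × Set J => p.2 ∈ 𝓝 (1 : J))
      (fun p => levelNhd ρ (N p.1) p.2) := by
  refine (filterBasis ρ N hdir hinv).nhds_one_hasBasis.to_hasBasis ?_ ?_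
  · rintro _ ⟨i, V, hV, rfl⟩
    exact ⟨(i, V), hV, subset_rfl⟩
  · rintro ⟨i, V⟩ hV
    exact ⟨_, ⟨i, V, hV, rfl⟩, subset_rfl⟩

/-- Each `levelNhd (N i) V`, `V ∈ 𝓝 1`, is a neighbourhood of `1`. [cite: MochizukiSemiAnbd2006, §0 p.5] -/
theorem levelNhd_mem_nhds_one (i : ι) {V : Set J} (hV : V ∈ 𝓝 (1 : J)) :
    levelNhd ρ (N i) V ∈ @nhds _ (topology ρ N hdir hinv) 1 :=
  (hasBasis_nhds_one ρ N hdir hinv).mem_of_mem (i := (i, V)) hV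

/-! ### The projection to `J` -/

/-- **The projection `G ⋊^out J → J` is continuous.** [cite: MochizukiSemiAnbd2006, §0 p.5] -/
theorem continuous_snd :
    @Continuous _ _ (topology ρ N hdir hinv) _ (outerSemidirectProductSnd ρ) := by
  letI := topology ρ N hdir hinv
  haveI := isTopologicalGroup ρ N hdir hinv
  refine continuous_of_continuousAt_one (outerSemidirectProductSnd ρ) ?_
  rw [ContinuousAt, map_one]
  intro V hV
  exact Filter.mem_map.mpr (Filter.mem_of_superset
    (levelNhd_mem_nhds_one ρ N hdir hinv (Classical.arbitrary ι) hV) fun e he => he.2)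

/-- **The projection `G ⋊^out J → J` is OPEN, provided the outer action is continuous along the
levels**: for every level `N i`, the elements of `J` whose outer class has a representative congruent to
the identity modulo `N i` form a neighbourhood of `1`. [cite: MochizukiSemiAnbd2006, §0 p.5] -/
theorem isOpenMap_snd_of_levels
    (hcont : ∀ i, {j : J | ∃ e : outerSemidirectProduct ρ,
      (∀ g : G, g⁻¹ * (e.1.1 : MulAut G) g ∈ N i) ∧ e.1.2 = j} ∈ 𝓝 (1 : J)) :
    @IsOpenMap _ _ (topology ρ N hdir hinv) _ (outerSemidirectProductSnd ρ) := by
  letI := topology ρ N hdir hinv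
  haveI := isTopologicalGroup ρ N hdir hinv
  refine (IsTopologicalGroup.isOpenMap_iff_nhds_one (f := outerSemidirectProductSnd ρ)).mpr ?_
  rw [(hasBasis_nhds_one ρ N hdir hinv).map _ |>.ge_iff]
  rintro ⟨i, V⟩ hV
  refine Filter.mem_of_superset (Filter.inter_mem (hcont i) hV) ?_
  rintro j ⟨⟨e, he, rfl⟩, hj⟩
  exact ⟨e, ⟨he, hj⟩, rfl⟩

/-! ### Separation -/

omit [Nonempty ι] in
/-- **`G ⋊^out J` is Hausdorff** when `J` is Hausdorff and the levels separate the points of a `T₁`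
group `G` (e.g. form a neighbourhood basis of `1` in a Hausdorff `G`). [cite: MochizukiSemiAnbd2006, §0 p.5] -/
theorem t2Space_of [Nonempty ι] [T1Space G] [T2Space J]
    (hbasis : ∀ U ∈ 𝓝 (1 : G), ∃ i, ((N i : Subgroup G) : Set G) ⊆ U) :
    @T2Space (outerSemidirectProduct ρ) (topology ρ N hdir hinv) := by
  letI := topology ρ N hdir hinv
  haveI := isTopologicalGroup ρ N hdir hinv
  refine IsTopologicalGroup.t2Space_of_one_sep fun e he => ?_
  by_cases hj : e.1.2 = 1
  · -- the `Aut`-component is not the identity: some `g⁻¹ φ(g) ≠ 1` escapes some level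
    have hφ : (e.1.1 : MulAut G) ≠ 1 := by
      intro h
      apply he
      apply Subtype.ext
      refine Prod.ext (Subtype.ext h) hj
    obtain ⟨g, hg⟩ : ∃ g : G, (e.1.1 : MulAut G) g ≠ g := by
      by_contra h
      push Not at h
      exact hφ (MulEquiv.ext h)
    have hne : g⁻¹ * (e.1.1 : MulAut G) g ≠ 1 := by
      intro h
      apply hg
      rw [mul_eq_one_iff_eq_inv] at h
      exact (inv_injective h).symm
    obtain ⟨i, hi⟩ := hbasis _ (compl_singleton_mem_nhds hne.symm)
    refine ⟨_, levelNhd_mem_nhds_one ρ N hdir hinv i Filter.univ_mem, fun hmem => ?_⟩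
    exact hi (hmem.1 g) rfl
  · refine ⟨_, levelNhd_mem_nhds_one ρ N hdir hinv (Classical.arbitrary ι)
      (compl_singleton_mem_nhds (Ne.symm hj)), fun hmem => hmem.2 rfl⟩

/-! ### The map `G → G ⋊^out J` -/

variable [IsTopologicalGroup G]

/-- **`G → G ⋊^out J` is continuous** when the (normal) levels are neighbourhoods of `1` in `G`.
[cite: MochizukiSemiAnbd2006, §0 p.5] -/
theorem continuous_toOuterSemidirectProduct (hnormal : ∀ i, (N i).Normal)
    (hnhds : ∀ i, ((N i : Subgroup G) : Set G) ∈ 𝓝 (1 : G)) :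
    @Continuous _ _ _ (topology ρ N hdir hinv) (toOuterSemidirectProduct ρ) := by
  letI := topology ρ N hdir hinv
  haveI := isTopologicalGroup ρ N hdir hinv
  refine continuous_of_continuousAt_one (toOuterSemidirectProduct ρ) ?_
  rw [ContinuousAt, map_one, (hasBasis_nhds_one ρ N hdir hinv).tendsto_right_iff]
  rintro ⟨i, V⟩ hV
  haveI := hnormal i
  filter_upwards [hnhds i] with g hg
  exact ⟨fun x => congr_conj_of_mem hg x, mem_of_mem_nhds hV⟩

/-- **`G → G ⋊^out J` is a topological embedding (inducing)** when, in addition, the subgroups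
`{g | ∀ x, x⁻¹ g x g⁻¹ ∈ N i}` ("central modulo `N i`") shrink to `1` — automatic for COMPACT
centre-free `G` with `N` a basis of open normal subgroups (profinite packaging file).
[cite: MochizukiSemiAnbd2006, §0 p.5] -/
theorem isInducing_toOuterSemidirectProduct_of (hnormal : ∀ i, (N i).Normal)
    (hnhds : ∀ i, ((N i : Subgroup G) : Set G) ∈ 𝓝 (1 : G))
    (hcentral : ∀ U ∈ 𝓝 (1 : G), ∃ i, {g : G | ∀ x : G, x⁻¹ * (g * x * g⁻¹) ∈ N i} ⊆ U) :
    @Topology.IsInducing _ _ _ (topology ρ N hdir hinv) (toOuterSemidirectProduct ρ) := by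
  letI := topology ρ N hdir hinv
  haveI := isTopologicalGroup ρ N hdir hinv
  refine (IsTopologicalGroup.isInducing_iff_nhds_one (f := toOuterSemidirectProduct ρ)).mpr ?_
  apply le_antisymm
  · -- continuity
    have h := (continuous_toOuterSemidirectProduct ρ N hdir hinv hnormal hnhds).tendsto 1
    rw [map_one] at h
    exact h.le_comap
  · refine ((hasBasis_nhds_one ρ N hdir hinv).comap (toOuterSemidirectProduct ρ)).le_iff.mpr ?_
    intro U hU
    obtain ⟨i, hi⟩ := hcentral U hU
    exact ⟨(i, Set.univ), Filter.univ_mem, fun g hg => hi fun x => hg.1 x⟩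

end Topology

end outerSemidirectProduct

end Literature.AnabelianGeometry.SemiGraphs
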